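import Literature.AlgebraicGeometry.Morphisms.CechModuleAffine
import HarnessLib

/-!
# Surjectivity of `Ȟ¹` under refinement for affine covers; independence of `Ȟ¹` of the affine cover

Sequel of `Literature/AlgebraicGeometry/Morphisms/CechModuleRefinement.lean` (refinement maps
`ρ : Č(𝒰, M) → Č(𝒱, M)` for `τ : 𝒱 → 𝒰`, `V_j ⊆ U_{τ j}`, and the INJECTIVITY of `Ȟ¹(𝒰, M) → Ȟ¹(𝒱, M)`
when `𝒱` covers every `U_i`, Görtz–Wedhorn II Cor. 21.81) and `CechModuleAffine.lean` (vanishing of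
`Ȟ¹` of an affine-localizing — e.g. quasi-coherent — module on every family of opens covering an
AFFINE open, Görtz–Wedhorn II Lemma 22.1).  For a scheme `f : X → Spec A`, an affine-localizing
`𝒪_X`-module `M`, a family `𝒰 = (U_i)` of AFFINE opens and a refinement `𝒱 = (V_j)`, `τ`, covering
every `U_i`:

* `exists_sub_refineMC1_mem_cechMB1` — **SURJECTIVITY of `Ȟ¹(𝒰, M) → Ȟ¹(𝒱, M)`** in cocycle form:
  every `1`-cocycle `c` of `M` on `𝒱` is cohomologous to the refinement of a `1`-cocycle `γ` on `𝒰`.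
  Proof: on each affine `U_i` the cocycle `c|_{U_i}` (on the family `(U_i ∩ V_j)_j` covering `U_i`)
  is a coboundary `d⁰ hⁱ`; two such local trivializations differ by sections `hⁱ_j - h^{i'}_j` which
  agree on overlaps, hence glue to `γ_{ii'} ∈ Γ(U_i ∩ U_{i'}, M)`; `γ` is a cocycle and
  `c - ρ γ = d⁰ e` with `e_j = h^{τ j}_j`;
* `cechMZ1_le_cechMB1_of_refine` / `cechMZ1_le_cechMB1_of_refine'` — vanishing of `Ȟ¹` passes from
  `𝒰` to `𝒱` (surjectivity) and from `𝒱` to `𝒰` (injectivity, tree);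
* `subsingleton_cechMH1_iff_of_isAffineOpen` — **independence of the affine cover**: for two
  families of affine opens `𝒰`, `𝒰'` both covering `X`, `Ȟ¹(𝒰, M) = 0 ↔ Ȟ¹(𝒰', M) = 0` (through
  the common refinement `(U_i ∩ U'_{i'})_{(i,i')}`).

This is the cover-independence half of "Čech cohomology of a quasi-coherent sheaf may be computed
on any affine open cover" (Hartshorne III Thm. 4.5) in degree `1`, proved Čech-internally (no
derived functors, no separatedness: only the members of the two covers need be affine).
Everything is proved; no named facts. Mathlib searched (pin v4.32): no Čech cohomology of sheaves of
modules (cf. `CechModule.lean`).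

## References

* R. Hartshorne, *Algebraic Geometry*, GTM 52 (1977): III Thm. 4.5 (p. 222), III Lemma 4.4.
  [Hartshorne1977]
* U. Görtz, T. Wedhorn, *Algebraic Geometry II* (2023): Cor. 21.81 (p. 265), Lemma 22.1 (p. 327).
  [GortzWedhorn2023]
-/

noncomputable section

open CategoryTheory AlgebraicGeometry Limits TopologicalSpace Opposite

universe u v w

namespace Literature.AlgebraicGeometry.Morphisms

variable {A : Type u} [CommRing A] {X : Scheme.{u}} (f : X ⟶ Spec (.of A)) {M : X.Modules}
  (hM : Literature.AlgebraicGeometry.Modules.IsAffineLocalizing M)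

section Refine

variable {ι : Type v} {ι' : Type w} (U : ι → X.Opens) (V : ι' → X.Opens)

/-- **Vanishing of `Ȟ¹` passes from a refinement to the coarser family** (injectivity, tree
`mem_cechMB1_of_refineMC1_mem_cechMB1`): if `𝒱` covers every `U_i` and every `1`-cocycle of `M` on
`𝒱` is a coboundary, then every `1`-cocycle of `M` on `𝒰` is a coboundary.
[cite: GortzWedhorn2023, Cor. 21.81 (p. 265)] -/
theorem cechMZ1_le_cechMB1_of_refine' (τ : ι' → ι) (hτ : ∀ j, V j ≤ U (τ j))
    (hU : ∀ i, U i ≤ ⨆ j, V j)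
    (hV : cechMZ1 f M V ≤ cechMB1 f M V) : cechMZ1 f M U ≤ cechMB1 f M U :=
  fun _ hc => mem_cechMB1_of_refineMC1_mem_cechMB1 f M U V τ hτ hU hc
    (hV (refineMC1_mem_cechMZ1 f M U V τ hτ hc))

include hM

/-- **Surjectivity of `Ȟ¹(𝒰, M) → Ȟ¹(𝒱, M)` for affine `U_i`** (cocycle form): for `M`
affine-localizing, `U_i` affine and a refinement `𝒱` covering every `U_i`, every `1`-cocycle `c`
of `M` on `𝒱` differs from the refinement of some `1`-cocycle `γ` on `𝒰` by a coboundary.  (On the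
affine `U_i`, `c|_{U_i}` is a coboundary `d⁰ hⁱ` of the family `(U_i ∩ V_j)_j`; the differences
`hⁱ_j - h^{i'}_j` glue over `j` to `γ_{ii'}`; `c - ρ γ = d⁰ (h^{τ j}_j)_j`.)
[cite: Hartshorne1977, III Thm. 4.5 p. 222 (cover independence, degree 1)] -/
theorem exists_sub_refineMC1_mem_cechMB1 (τ : ι' → ι) (hτ : ∀ j, V j ≤ U (τ j))
    (hUaff : ∀ i, IsAffineOpen (U i)) (hU : ∀ i, U i ≤ ⨆ j, V j) {c : CechMC1 f M V}
    (hc : c ∈ cechMZ1 f M V) :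
    ∃ γ ∈ cechMZ1 f M U, c - cechMRefineC1 f M U V τ hτ γ ∈ cechMB1 f M V := by
  -- the families `(U_i ∩ V_j)_j` covering the affine `U_i`
  have hcov : ∀ i, ⨆ j, U i ⊓ V j = U i := fun i => by
    rw [← inf_iSup_eq]; exact inf_eq_left.mpr (hU i)
  -- Step 1: on each `U_i` the restricted cocycle is a coboundary `d⁰ hⁱ`
  have htriv : ∀ i, ∃ h : CechMC0 f M (fun j => U i ⊓ V j),
      cechMD0 f M (fun j => U i ⊓ V j) h =
        cechMRefineC1 f M V (fun j => U i ⊓ V j) id (fun j => inf_le_right) c := by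
    intro i
    have hz := refineMC1_mem_cechMZ1 f M V (fun j => U i ⊓ V j) id (fun j => inf_le_right) hc
    exact (mem_cechMB1_iff f M _ _).mp
      (cechMZ1_le_cechMB1_of_isAffineOpen f hM (hUaff i) (fun j => U i ⊓ V j) (hcov i) hz)
  choose h hh using htriv
  -- `hh' i j j'`: `hⁱ_{j'} - hⁱ_j = c_{jj'}` on `(U_i ∩ V_j) ∩ (U_i ∩ V_{j'})`
  have hh' : ∀ i j j', MSections.res f M inf_le_right (h i j') - MSections.res f M inf_le_left (h i j)
      = MSections.res f M (inf_le_inf inf_le_right inf_le_right) (c j j') := fun i j j' => by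
    have := congrFun (congrFun (hh i) j) j'
    rw [cechMD0_apply, cechMRefineC1_apply] at this
    exact this
  -- Step 2: the differences `hⁱ_j - h^{i'}_j` on `U_i ∩ U_{i'} ∩ V_j` glue over `j`
  have hAi : ∀ i i' j, (U i ⊓ U i') ⊓ V j ≤ U i ⊓ V j := fun i i' j =>
    inf_le_inf inf_le_left le_rfl
  have hAi' : ∀ i i' j, (U i ⊓ U i') ⊓ V j ≤ U i' ⊓ V j := fun i i' j =>
    inf_le_inf inf_le_right le_rfl
  set s : ∀ i i' j, MSections f M ((U i ⊓ U i') ⊓ V j) := fun i i' j =>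
    MSections.res f M (hAi i i' j) (h i j) - MSections.res f M (hAi' i i' j) (h i' j) with hs
  have hglue : ∀ i i' j j',
      MSections.res f M (inf_le_left : ((U i ⊓ U i') ⊓ V j) ⊓ ((U i ⊓ U i') ⊓ V j') ≤ _)
        (s i i' j) =
      MSections.res f M (inf_le_right : ((U i ⊓ U i') ⊓ V j) ⊓ ((U i ⊓ U i') ⊓ V j') ≤ _)
        (s i i' j') := by
    intro i i' j j'
    simp only [hs, map_sub, MSections.res_res]
    -- restrict the two trivializations to `Q = U_i ∩ U_{i'} ∩ V_j ∩ V_{j'}`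
    have hQi : ((U i ⊓ U i') ⊓ V j) ⊓ ((U i ⊓ U i') ⊓ V j') ≤ (U i ⊓ V j) ⊓ (U i ⊓ V j') :=
      inf_le_inf (hAi i i' j) (hAi i i' j')
    have hQi' : ((U i ⊓ U i') ⊓ V j) ⊓ ((U i ⊓ U i') ⊓ V j') ≤ (U i' ⊓ V j) ⊓ (U i' ⊓ V j') :=
      inf_le_inf (hAi' i i' j) (hAi' i i' j')
    have h1 := congrArg (MSections.res f M hQi) (hh' i j j')
    have h2 := congrArg (MSections.res f M hQi') (hh' i' j j')
    rw [map_sub, MSections.res_res, MSections.res_res, MSections.res_res] at h1 h2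
    have key : ∀ (Hij Hij' Hi'j Hi'j' C : MSections f M (((U i ⊓ U i') ⊓ V j) ⊓ ((U i ⊓ U i') ⊓ V j'))),
        Hij' - Hij = C → Hi'j' - Hi'j = C → Hij - Hi'j = Hij' - Hi'j' := by
      intro Hij Hij' Hi'j Hi'j' C e1 e2
      rw [← sub_eq_zero]
      have : Hij - Hi'j - (Hij' - Hi'j') = (Hi'j' - Hi'j) - (Hij' - Hij) := by abel
      rw [this, e1, e2, sub_self]
    exact key _ _ _ _ _ h1 h2
  have hcov2 : ∀ i i', U i ⊓ U i' ≤ ⨆ j, (U i ⊓ U i') ⊓ V j := fun i i' => by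
    rw [← inf_iSup_eq]; exact le_inf le_rfl (inf_le_left.trans (hU i))
  choose γ hγ using fun i i' => MSections.exists_res_eq f M (fun j => (U i ⊓ U i') ⊓ V j)
    (fun j => inf_le_left) (hcov2 i i') (s i i') (hglue i i')
  -- `hγ i i' j : res (γ i i') = s i i' j` on `U_i ∩ U_{i'} ∩ V_j`
  refine ⟨γ, ?_, ?_⟩
  · -- Step 3: `γ` is a cocycle (check locally on the `V_j`)
    rw [mem_cechMZ1_iff]
    funext i i' i''
    rw [Pi.zero_apply, Pi.zero_apply, Pi.zero_apply]
    apply MSections.eq_of_res_eq f M (fun j => (U i ⊓ U i' ⊓ U i'') ⊓ V j) (fun j => inf_le_left)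
    · rw [← inf_iSup_eq]; exact le_inf le_rfl ((inf_le_left.trans inf_le_left).trans (hU i))
    intro j
    have hR1 : (U i ⊓ U i' ⊓ U i'') ⊓ V j ≤ (U i' ⊓ U i'') ⊓ V j :=
      inf_le_inf (le_inf (inf_le_left.trans inf_le_right) inf_le_right) le_rfl
    have hR2 : (U i ⊓ U i' ⊓ U i'') ⊓ V j ≤ (U i ⊓ U i'') ⊓ V j :=
      inf_le_inf (le_inf (inf_le_left.trans inf_le_left) inf_le_right) le_rfl
    have hR3 : (U i ⊓ U i' ⊓ U i'') ⊓ V j ≤ (U i ⊓ U i') ⊓ V j :=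
      inf_le_inf inf_le_left le_rfl
    have g1 := congrArg (MSections.res f M hR1) (hγ i' i'' j)
    have g2 := congrArg (MSections.res f M hR2) (hγ i i'' j)
    have g3 := congrArg (MSections.res f M hR3) (hγ i i' j)
    simp only [hs, map_sub, MSections.res_res] at g1 g2 g3
    rw [map_zero, cechMD1_apply, map_add, map_sub, MSections.res_res, MSections.res_res,
      MSections.res_res]
    erw [g1, g2, g3]
    have key : ∀ (Hi Hi' Hi'' : MSections f M ((U i ⊓ U i' ⊓ U i'') ⊓ V j)),
        Hi' - Hi'' - (Hi - Hi'') + (Hi - Hi') = 0 := by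
      intro Hi Hi' Hi''; abel
    exact key _ _ _
  · -- Step 4: `c - ρ γ = d⁰ e` with `e_j = h^{τ j}_j`
    refine (mem_cechMB1_iff f M V _).mpr ⟨fun j => MSections.res f M (le_inf (hτ j) le_rfl) (h (τ j) j), ?_⟩
    funext j j'
    rw [cechMD0_apply, Pi.sub_apply, Pi.sub_apply, cechMRefineC1_apply, MSections.res_res,
      MSections.res_res]
    -- on `P = V_j ∩ V_{j'}`: `c = h^{τj}_{j'} - h^{τj}_j` and `γ_{τj,τj'} = h^{τj}_{j'} - h^{τj'}_{j'}`
    have hP : V j ⊓ V j' ≤ (U (τ j) ⊓ V j) ⊓ (U (τ j) ⊓ V j') :=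
      le_inf (le_inf (inf_le_left.trans (hτ j)) inf_le_left)
        (le_inf (inf_le_left.trans (hτ j)) inf_le_right)
    have hP' : V j ⊓ V j' ≤ (U (τ j) ⊓ U (τ j')) ⊓ V j' :=
      le_inf (inf_le_inf (hτ j) (hτ j')) inf_le_right
    have e1 := congrArg (MSections.res f M hP) (hh' (τ j) j j')
    have e2 := congrArg (MSections.res f M hP') (hγ (τ j) (τ j') j')
    simp only [hs, map_sub, MSections.res_res, MSections.res_self] at e1 e2
    rw [MSections.res_eq_res f M _ (inf_le_inf (hτ j) (hτ j')) (γ (τ j) (τ j'))] at e2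
    rw [e2]
    have key : ∀ (C Hj Hj' H'j' : MSections f M (V j ⊓ V j')),
        Hj' - Hj = C → H'j' - Hj = C - (Hj' - H'j') := by
      intro C Hj Hj' H'j' e
      rw [← e]; abel
    exact key _ _ _ _ e1

/-- **Vanishing of `Ȟ¹` passes from an affine family to any refinement covering it** (surjectivity,
`exists_sub_refineMC1_mem_cechMB1`): for `M` affine-localizing, `U_i` affine and `𝒱` covering every
`U_i`, if every `1`-cocycle on `𝒰` is a coboundary then so is every `1`-cocycle on `𝒱`.
[cite: Hartshorne1977, III Thm. 4.5 p. 222 (cover independence, degree 1)] -/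
theorem cechMZ1_le_cechMB1_of_refine (τ : ι' → ι) (hτ : ∀ j, V j ≤ U (τ j))
    (hUaff : ∀ i, IsAffineOpen (U i)) (hU : ∀ i, U i ≤ ⨆ j, V j)
    (hUZ : cechMZ1 f M U ≤ cechMB1 f M U) : cechMZ1 f M V ≤ cechMB1 f M V := by
  intro c hc
  obtain ⟨γ, hγ, hdiff⟩ := exists_sub_refineMC1_mem_cechMB1 f hM U V τ hτ hUaff hU hc
  have hρ := refineMC1_mem_cechMB1 f M U V τ hτ (hUZ hγ)
  have := Submodule.add_mem _ hdiff hρ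
  rwa [sub_add_cancel] at this

end Refine

/-! ## Independence of the affine cover -/

section TwoCovers

omit hM in
/-- `Ȟ¹(𝒰, M)` is zero iff every `1`-cocycle is a coboundary. [folklore] -/
private theorem subsingleton_cechMH1_iff {ι : Type v} (U : ι → X.Opens) :
    Subsingleton (CechMH1 f M U) ↔ cechMZ1 f M U ≤ cechMB1 f M U := by
  constructor
  · intro h c hc
    exact (CechMH1.mk_eq_zero_iff f M U ⟨c, hc⟩).mp (Subsingleton.elim _ _)
  · intro h
    refine ⟨fun x y => ?_⟩
    obtain ⟨z, rfl⟩ := CechMH1.mk_surjective f M U x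
    obtain ⟨z', rfl⟩ := CechMH1.mk_surjective f M U y
    rw [CechMH1.mk_eq_mk_iff]
    exact h (Submodule.sub_mem _ z.2 z'.2)

variable {ι : Type v} {ι' : Type w} (U : ι → X.Opens) (U' : ι' → X.Opens)

omit hM in
/-- The common refinement `(U_i ∩ U'_{i'})_{(i,i')}` covers every `U_i` when `𝒰'` covers `X`.
[folklore] -/
private theorem le_iSup_inf_of_iSup_eq_top (hU' : ⨆ i', U' i' = ⊤) (i : ι) :
    U i ≤ ⨆ p : ι × ι', U p.1 ⊓ U' p.2 := by
  have h : U i ≤ ⨆ i', U i ⊓ U' i' := by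
    rw [← inf_iSup_eq, hU', inf_top_eq]
  exact h.trans (iSup_le fun i' => le_iSup (fun p : ι × ι' => U p.1 ⊓ U' p.2) (i, i'))

omit hM in
/-- The common refinement `(U_i ∩ U'_{i'})_{(i,i')}` covers every `U'_{i'}` when `𝒰` covers `X`.
[folklore] -/
private theorem le_iSup_inf_of_iSup_eq_top' (hU : ⨆ i, U i = ⊤) (i' : ι') :
    U' i' ≤ ⨆ p : ι × ι', U p.1 ⊓ U' p.2 := by
  have h : U' i' ≤ ⨆ i, U i ⊓ U' i' := by
    rw [← iSup_inf_eq, hU, top_inf_eq]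
  exact h.trans (iSup_le fun i => le_iSup (fun p : ι × ι' => U p.1 ⊓ U' p.2) (i, i'))

include hM

/-- **Independence of `Ȟ¹(𝒰, M) = 0` of the affine cover**: for `M` affine-localizing (e.g.
quasi-coherent) and two families `𝒰`, `𝒰'` of AFFINE opens each covering `X`, every `1`-cocycle of
`M` on `𝒰` is a coboundary iff every `1`-cocycle on `𝒰'` is — both are equivalent to the same
statement on the common refinement `(U_i ∩ U'_{i'})_{(i,i')}` (surjectivity
`cechMZ1_le_cechMB1_of_refine` one way, injectivity `cechMZ1_le_cechMB1_of_refine'` back).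
[cite: Hartshorne1977, III Thm. 4.5 p. 222 (cover independence, degree 1)] -/
theorem cechMZ1_le_cechMB1_iff_of_isAffineOpen (hUaff : ∀ i, IsAffineOpen (U i))
    (hU'aff : ∀ i', IsAffineOpen (U' i')) (hU : ⨆ i, U i = ⊤) (hU' : ⨆ i', U' i' = ⊤) :
    cechMZ1 f M U ≤ cechMB1 f M U ↔ cechMZ1 f M U' ≤ cechMB1 f M U' := by
  let W : ι × ι' → X.Opens := fun p => U p.1 ⊓ U' p.2
  have hWU : ∀ i, U i ≤ ⨆ p, W p := le_iSup_inf_of_iSup_eq_top U U' hU'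
  have hWU' : ∀ i', U' i' ≤ ⨆ p, W p := le_iSup_inf_of_iSup_eq_top' U U' hU
  constructor
  · intro h
    exact cechMZ1_le_cechMB1_of_refine' f U' W Prod.snd (fun p => inf_le_right) hWU'
      (cechMZ1_le_cechMB1_of_refine f hM U W Prod.fst (fun p => inf_le_left) hUaff hWU h)
  · intro h
    exact cechMZ1_le_cechMB1_of_refine' f U W Prod.fst (fun p => inf_le_left) hWU
      (cechMZ1_le_cechMB1_of_refine f hM U' W Prod.snd (fun p => inf_le_right) hU'aff hWU' h)

/-- **`Ȟ¹(𝒰, M) = 0 ↔ Ȟ¹(𝒰', M) = 0` for two affine open covers** of `X` and `M` affine-localizing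
(e.g. quasi-coherent) — the class form of `cechMZ1_le_cechMB1_iff_of_isAffineOpen`.
[cite: Hartshorne1977, III Thm. 4.5 p. 222 (cover independence, degree 1)] -/
theorem subsingleton_cechMH1_iff_of_isAffineOpen (hUaff : ∀ i, IsAffineOpen (U i))
    (hU'aff : ∀ i', IsAffineOpen (U' i')) (hU : ⨆ i, U i = ⊤) (hU' : ⨆ i', U' i' = ⊤) :
    Subsingleton (CechMH1 f M U) ↔ Subsingleton (CechMH1 f M U') := by
  rw [subsingleton_cechMH1_iff, subsingleton_cechMH1_iff]
  exact cechMZ1_le_cechMB1_iff_of_isAffineOpen f hM U U' hUaff hU'aff hU hU'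

end TwoCovers

end Literature.AlgebraicGeometry.Morphisms

end
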